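import Mathlib.Combinatorics.SimpleGraph.AdjMatrix
import Mathlib.Combinatorics.SimpleGraph.DegreeSum
import Literature.Probability.LatticeModels.KacSiegertTransform
import Literature.Probability.LatticeModels.HSLangevinPairChain
import HarnessLib

/-!
# The Kac–Siegert transform, II: read-out kernel, nearest-neighbour Ising model, discrete torus

Topic `Literature/Probability/LatticeModels`; continuation of `KacSiegertTransform.lean`
(definition request `defn-HSLangevinPairChain`, route CriticalPhenomena/Ising3DConformalLimit
`SynchronousCoupling`), stated in the vocabulary of `HSLangevinPairChain.lean`
(`HSLangevin.couplingMatrix G κ β = κ·1 + β·J_G`, `HSLangevin.Mop`, `HSLangevin.tanhField`,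
`HSLangevin.readoutProb`).

* READ-OUT KERNEL (general symmetric coercive `M`): `readoutWeight M ψ σ = ∏_x (1 + σ_x tanh((Mψ)_x))/2`
  is the product Bernoulli law `P(σ | ψ)` with `P(σ_x = 1 | ψ) = (1 + tanh((Mψ)_x))/2`
  (`= HSLangevin.readoutProb`); `fieldWeight(ψ) · P(σ|ψ) = jointWeight(σ, ψ)`
  (`fieldWeight_mul_readoutWeight`), whence the DISINTEGRATION / σ-MARGINAL identity
  `∫ (∑_σ f(σ) P(σ|ψ)) fieldMeasure(dψ) = ∑_σ f(σ) e^{½σᵀMσ} / ∑_σ e^{½σᵀMσ}`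
  (`integral_sum_mul_readoutWeight_fieldMeasure`): sampling `ψ` from the field law and then the
  spins independently with these probabilities produces EXACTLY the Gibbs law of `M`
  (BBD 2024 §6.4.1, `E_μ F = E_{ν_0} E_{μ_0^φ} F`).
* NEAREST-NEIGHBOUR ISING: `spinVec_adjMatrix_spinVec` (`σᵀJ_Gσ = 2∑_{edges} σσ`),
  `gibbsWeight_couplingMatrix` (`exp(½σᵀMσ) = e^{κ|V|/2} e^{-βH^{free}_{V;0}(σ)}`),
  `sum_mul_gibbsWeight_div_eq_integral_isingMeasure` (Gibbs averages of `M = κ·1 + β·J_G` are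
  integrals against `isingMeasure G univ β 0 free`), `isCoercive_couplingMatrix` (`κ > |β|Δ`);
  hence **HS exactness** for the Ising model on a finite graph with free boundary condition on
  its whole vertex set (periodic b.c. for the torus graph):
  `integral_tanhField_mul_tanhField_eq_isingTwoPoint` (`x ≠ y`),
  `integral_sum_mul_readoutWeight_eq_integral_isingMeasure` (all measurable `f`), and on the
  discrete torus `integral_tanhField_mul_tanhField_Mop` (`= isingTorusTwoPoint d N β 0 x y` for
  `2d|β| < κ`).

Sources as in part I (Bauerschmidt–Bodineau–Dagallier 2024 §6.4.1; Bauerschmidt–Dagallier 2024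
§1.1–1.2). Everything is proved; no named facts.
-/

noncomputable section

open MeasureTheory Matrix Finset Real

namespace Literature.Probability.LatticeModels

namespace KacSiegert

variable {V : Type*} [Fintype V] [DecidableEq V]

/-! ### The read-out kernel `P(σ | ψ)` and the disintegration identity -/

section Readout

/-- The READ-OUT KERNEL: the product Bernoulli weight
`readoutWeight M ψ σ = ∏_x (1 + σ_x tanh((Mψ)_x))/2 = P(σ | ψ)` of the spins given the Kac–Siegert
field (`P(σ_x = 1 | ψ) = (1 + tanh((Mψ)_x))/2 = HSLangevin.readoutProb M ψ x`; the infinite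
temperature Ising model with external field `Mψ`, BBD 2024 §6.4.1). [cite: BauerschmidtBodineauDagallier2024Polchinski, §6.4.1] -/
def readoutWeight (M : Matrix V V ℝ) (ψ : V → ℝ) (σ : SpinConfig V) : ℝ :=
  ∏ x, (1 + spinAt x σ * Real.tanh ((M *ᵥ ψ) x)) / 2

omit [DecidableEq V] in
/-- The one-site read-out probabilities are `HSLangevin.readoutProb` and its complement. [folklore] -/
theorem readoutWeight_eq_prod_readoutProb (M : Matrix V V ℝ) (ψ : V → ℝ) (σ : SpinConfig V) :
    readoutWeight M ψ σ =
      ∏ x, (if σ x = 1 then HSLangevin.readoutProb M ψ x else 1 - HSLangevin.readoutProb M ψ x) := by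
  refine Finset.prod_congr rfl fun x _ => ?_
  rcases Int.units_eq_one_or (σ x) with h | h
  · simp [h, spinAt, HSLangevin.readoutProb, HSLangevin.tanhField]
  · simp only [h, spinAt, HSLangevin.readoutProb, HSLangevin.tanhField, Units.val_neg, Units.val_one,
      Int.cast_neg, Int.cast_one]
    rw [if_neg (by decide)]
    ring

omit [DecidableEq V] in
/-- The one-site identity `(1 + s·tanh a)/2 = e^{sa}/(e^a + e^{-a})` for `s = ±1`. [folklore] -/
theorem one_add_mul_tanh_div_two (s : ℤˣ) (a : ℝ) :
    (1 + ((s : ℤ) : ℝ) * Real.tanh a) / 2 = Real.exp (((s : ℤ) : ℝ) * a) / (Real.exp a + Real.exp (-a)) := by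
  have h0 : Real.exp a + Real.exp (-a) ≠ 0 := by positivity
  rcases Int.units_eq_one_or s with h | h
  · subst h
    rw [Real.tanh_eq]
    field_simp
    push_cast
    ring
  · subst h
    rw [Real.tanh_eq]
    field_simp
    push_cast
    ring_nf

omit [DecidableEq V] in
/-- Read-out weights are nonnegative (`|tanh| < 1`, `σ_x = ±1`). [folklore] -/
theorem readoutWeight_nonneg (M : Matrix V V ℝ) (ψ : V → ℝ) (σ : SpinConfig V) :
    0 ≤ readoutWeight M ψ σ := by
  refine Finset.prod_nonneg fun x _ => div_nonneg ?_ zero_le_two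
  have h1 := Real.abs_tanh_lt_one ((M *ᵥ ψ) x)
  rcases spinAt_eq_one_or_eq_neg_one x σ with h | h <;> rw [h] <;>
    nlinarith [abs_lt.1 h1]

/-- Read-out weights sum to one over the spin configurations (a probability kernel). [folklore] -/
theorem sum_readoutWeight (M : Matrix V V ℝ) (ψ : V → ℝ) : ∑ σ : SpinConfig V, readoutWeight M ψ σ = 1 := by
  unfold readoutWeight
  simp only [spinAt]
  rw [sum_prod_units (fun x (s : ℤˣ) => (1 + ((s : ℤ) : ℝ) * Real.tanh ((M *ᵥ ψ) x)) / 2)]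
  refine Finset.prod_eq_one fun x _ => ?_
  push_cast
  ring

/-- **Field weight × read-out kernel = joint weight**:
`fieldWeight(ψ) · P(σ | ψ) = exp(-½ψᵀMψ + σᵀMψ)` — the Kac–Siegert joint law disintegrates over the
field into the product Bernoulli read-out (BBD 2024 §6.4.1, `t = 0`). [cite: BauerschmidtBodineauDagallier2024Polchinski, §6.4.1] -/
theorem fieldWeight_mul_readoutWeight (M : Matrix V V ℝ) (ψ : V → ℝ) (σ : SpinConfig V) :
    fieldWeight M ψ * readoutWeight M ψ σ = jointWeight M σ ψ := by
  rw [fieldWeight_eq_exp_mul_prod, jointWeight, Real.exp_add, exp_spinVec_dotProduct, gaussWeight,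
    readoutWeight, mul_assoc, ← Finset.prod_mul_distrib]
  congr 1
  refine Finset.prod_congr rfl fun x _ => ?_
  simp only [spinAt]
  rw [one_add_mul_tanh_div_two]
  have h0 : Real.exp ((M *ᵥ ψ) x) + Real.exp (-(M *ᵥ ψ) x) ≠ 0 := by positivity
  field_simp

/-- **Disintegration (σ-marginal) identity.** For symmetric coercive `M` and any `f`,
`∫ (∑_σ f(σ) P(σ|ψ)) fieldMeasure(dψ) = ∑_σ f(σ) e^{½σᵀMσ} / ∑_σ e^{½σᵀMσ}`: drawing the field from
`fieldMeasure M` and then the spins independently with `P(σ_x = 1|ψ) = (1 + tanh((Mψ)_x))/2`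
yields exactly the Gibbs law of `M` (BBD 2024 §6.4.1, `E_μ F = E_{ν_0} E_{μ_0^φ} F`). [cite: BauerschmidtBodineauDagallier2024Polchinski, §6.4.1] -/
theorem integral_sum_mul_readoutWeight_fieldMeasure {M : Matrix V V ℝ} {c : ℝ} (hM : IsCoercive M c)
    (hsymm : M.IsSymm) (f : SpinConfig V → ℝ) :
    ∫ ψ, ∑ σ : SpinConfig V, f σ * readoutWeight M ψ σ ∂fieldMeasure M =
      (∑ σ : SpinConfig V, f σ * gibbsWeight M σ) / ∑ σ : SpinConfig V, gibbsWeight M σ := by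
  rw [integral_fieldMeasure hM hsymm]
  have hpt : ∀ ψ : V → ℝ, fieldWeight M ψ * ∑ σ : SpinConfig V, f σ * readoutWeight M ψ σ =
      ∑ σ : SpinConfig V, f σ * jointWeight M σ ψ := by
    intro ψ
    rw [Finset.mul_sum]
    refine Finset.sum_congr rfl fun σ _ => ?_
    rw [← fieldWeight_mul_readoutWeight]
    ring
  simp_rw [hpt]
  rw [integral_finsetSum _ fun σ _ => (integral_jointWeight hM hsymm σ).1.const_mul _]
  simp_rw [integral_const_mul]
  rw [(integral_fieldWeight hM hsymm).2,
    show (∑ σ : SpinConfig V, f σ * ∫ ψ, jointWeight M σ ψ) =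
      (∑ σ : SpinConfig V, f σ * gibbsWeight M σ) * ∫ ψ, gaussWeight M ψ by
        rw [Finset.sum_mul]
        refine Finset.sum_congr rfl fun σ _ => ?_
        rw [(integral_jointWeight hM hsymm σ).2]
        ring,
    mul_div_mul_right _ _ (integral_gaussWeight_pos hM).ne']

end Readout

/-! ### The nearest-neighbour coupling operator `κ·1 + β·J` and the Ising measure -/

section Graph

variable (G : SimpleGraph V) [DecidableRel G.Adj]

/-- Weighted handshake: `σᵀ J_G σ = 2 ∑_{edges} σ_xσ_y` for the adjacency matrix `J_G`. [folklore] -/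
theorem spinVec_adjMatrix_spinVec (σ : SpinConfig V) :
    spinVec σ ⬝ᵥ G.adjMatrix ℝ *ᵥ spinVec σ = 2 * ∑ e ∈ G.edgeFinset, bondSpin σ e := by
  -- sum over darts, grouped by edges
  have h1 : ∑ d : G.Dart, bondSpin σ d.edge = 2 * ∑ e ∈ G.edgeFinset, bondSpin σ e := by
    rw [← Finset.sum_fiberwise_of_maps_to (s := (Finset.univ : Finset G.Dart)) (t := G.edgeFinset)
      (g := fun d : G.Dart => d.edge) (fun d _ => SimpleGraph.mem_edgeFinset.2 d.edge_mem)]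
    rw [Finset.mul_sum]
    refine Finset.sum_congr rfl fun e he => ?_
    rw [Finset.sum_congr rfl fun d hd => by rw [(Finset.mem_filter.1 hd).2], Finset.sum_const,
      nsmul_eq_mul, G.dart_edge_fiber_card e (SimpleGraph.mem_edgeFinset.1 he)]
    push_cast; ring
  -- sum over darts, grouped by first vertex
  have h2 : ∑ d : G.Dart, bondSpin σ d.edge = ∑ v, ∑ w ∈ G.neighborFinset v, bondSpin σ s(v, w) := by
    rw [← Finset.sum_fiberwise_of_maps_to (s := (Finset.univ : Finset G.Dart)) (t := Finset.univ)
      (g := fun d : G.Dart => d.fst) (fun _ _ => Finset.mem_univ _)]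
    refine Finset.sum_congr rfl fun v _ => ?_
    rw [SimpleGraph.dart_fst_fiber, Finset.sum_image fun a _ b _ h => G.dartOfNeighborSet_injective v h,
      Finset.sum_subtype (G.neighborFinset v) (fun w => SimpleGraph.mem_neighborFinset G v w)]
    rfl
  rw [← h1, h2, SimpleGraph.dotProduct_mulVec_adjMatrix]
  refine Finset.sum_congr rfl fun v _ => ?_
  rw [SimpleGraph.neighborFinset_eq_filter, Finset.sum_filter]
  rfl

/-- The Gibbs weight of `M = κ·1 + β·J_G` (`HSLangevin.couplingMatrix G κ β`) is the zero-field,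
free-boundary Ising weight on the whole (finite) graph up to the constant `e^{κ|V|/2}`:
`exp(½σᵀMσ) = e^{κ|V|/2} exp(-β H_{V;0}^{free}(σ))`. [folklore] -/
theorem gibbsWeight_couplingMatrix (κ β : ℝ) (σ : SpinConfig V) :
    gibbsWeight (HSLangevin.couplingMatrix G κ β) σ =
      Real.exp (κ * Fintype.card V / 2) *
        Real.exp (-β * isingHamiltonian G Finset.univ 0 .free σ) := by
  have hedges : edgesIn G Finset.univ = G.edgeFinset := by
    ext e
    rw [mem_edgesIn_iff, SimpleGraph.mem_edgeFinset]
    exact ⟨fun h => h.1, fun h => ⟨h, fun x _ => Finset.mem_univ x⟩⟩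
  have hself : spinVec σ ⬝ᵥ spinVec σ = Fintype.card V := by
    simp [dotProduct, Finset.card_univ]
  rw [gibbsWeight, HSLangevin.couplingMatrix, ← Real.exp_add, add_mulVec, dotProduct_add, smul_mulVec,
    smul_mulVec, one_mulVec, dotProduct_smul, dotProduct_smul, hself, spinVec_adjMatrix_spinVec,
    isingHamiltonian, interactionEdges_free, hedges]
  congr 1
  simp only [smul_eq_mul, sub_zero, zero_mul]
  ring

/-- Gibbs averages of the coupling operator `κ·1 + β·J_G` are Ising averages: for measurable `f`,
`∑_σ f(σ) e^{½σᵀMσ} / ∑_σ e^{½σᵀMσ} = ∫ f dμ^{free}_{V;β,0}` (the constant `e^{κ|V|/2}` cancels;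
finite configurations `univ → ℤˣ` glued with the free b.c. are all configurations). [folklore] -/
theorem sum_mul_gibbsWeight_div_eq_integral_isingMeasure (κ β : ℝ) {f : SpinConfig V → ℝ}
    (hf : Measurable f) :
    (∑ σ : SpinConfig V, f σ * gibbsWeight (HSLangevin.couplingMatrix G κ β) σ) /
        ∑ σ : SpinConfig V, gibbsWeight (HSLangevin.couplingMatrix G κ β) σ =
      ∫ σ, f σ ∂isingMeasure G Finset.univ β 0 .free := by
  rw [integral_isingMeasure G Finset.univ β 0 .free hf]
  -- reindex finite configurations `univ → ℤˣ` by total ones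
  set e : (↥(Finset.univ : Finset V) → ℤˣ) ≃ SpinConfig V :=
    Equiv.arrowCongr (Equiv.subtypeUnivEquiv fun v => Finset.mem_univ v) (Equiv.refl ℤˣ) with he
  have hglue : ∀ τ : ↥(Finset.univ : Finset V) → ℤˣ, glue Finset.univ τ .free = e τ := by
    intro τ
    funext v
    rw [glue_apply_of_mem _ _ _ (Finset.mem_univ v)]
    rfl
  simp_rw [isingPartitionFunction, isingWeight, hglue]
  rw [Equiv.sum_comp e (fun σ => Real.exp (-β * isingHamiltonian G Finset.univ 0 .free σ) * f σ),
    Equiv.sum_comp e (fun σ => Real.exp (-β * isingHamiltonian G Finset.univ 0 .free σ))]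
  simp_rw [gibbsWeight_couplingMatrix]
  have hc : Real.exp (κ * Fintype.card V / 2) ≠ 0 := (Real.exp_pos _).ne'
  rw [show (∑ σ : SpinConfig V, f σ *
        (Real.exp (κ * Fintype.card V / 2) * Real.exp (-β * isingHamiltonian G Finset.univ 0 .free σ))) =
      Real.exp (κ * Fintype.card V / 2) *
        ∑ σ : SpinConfig V, Real.exp (-β * isingHamiltonian G Finset.univ 0 .free σ) * f σ by
      rw [Finset.mul_sum]; refine Finset.sum_congr rfl fun σ _ => ?_; ring,
    ← Finset.mul_sum, mul_div_mul_left _ _ hc]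

omit [Fintype V] in
/-- The coupling operator `κ·1 + β·J_G` is symmetric. [folklore] -/
theorem isSymm_couplingMatrix (κ β : ℝ) : (HSLangevin.couplingMatrix G κ β).IsSymm :=
  (Matrix.isSymm_one.smul κ).add ((G.isSymm_adjMatrix (α := ℝ)).smul β)

/-- Coercivity of the nearest-neighbour coupling operator: if every vertex has degree `≤ Δ` then
`(κ - |β|Δ) ∑ ψ_x² ≤ ψᵀ(κ·1 + β·J_G)ψ`, so `M` is coercive as soon as `κ > |β|Δ`
(`Δ = 2d` on `ℤ^d` and on the torus). [folklore] -/
theorem isCoercive_couplingMatrix {κ β : ℝ} {Δ : ℕ} (hdeg : ∀ v, G.degree v ≤ Δ) (hκ : |β| * Δ < κ) :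
    IsCoercive (HSLangevin.couplingMatrix G κ β) (κ - |β| * Δ) := by
  classical
  refine ⟨sub_pos.2 hκ, fun ψ => ?_⟩
  have hself : ψ ⬝ᵥ ψ = ∑ x, ψ x ^ 2 := by simp [dotProduct, sq]
  -- `|ψᵀJψ| ≤ Δ ∑ ψ²` by `2ab ≤ a² + b²` on each ordered adjacent pair
  have hA : |ψ ⬝ᵥ G.adjMatrix ℝ *ᵥ ψ| ≤ Δ * ∑ x, ψ x ^ 2 := by
    rw [SimpleGraph.dotProduct_mulVec_adjMatrix]
    have hhalf : ∀ i j : V, |(if G.Adj i j then ψ i * ψ j else 0)| ≤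
        (if G.Adj i j then (ψ i ^ 2 + ψ j ^ 2) / 2 else 0) := by
      intro i j
      split_ifs
      · rw [abs_le]; constructor <;> nlinarith [sq_nonneg (ψ i + ψ j), sq_nonneg (ψ i - ψ j)]
      · simp
    calc |∑ i, ∑ j, (if G.Adj i j then ψ i * ψ j else 0)|
        ≤ ∑ i, ∑ j, |(if G.Adj i j then ψ i * ψ j else 0)| := by
          refine (Finset.abs_sum_le_sum_abs _ _).trans (Finset.sum_le_sum fun i _ => ?_)
          exact Finset.abs_sum_le_sum_abs _ _
      _ ≤ ∑ i, ∑ j, (if G.Adj i j then (ψ i ^ 2 + ψ j ^ 2) / 2 else 0) :=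
          Finset.sum_le_sum fun i _ => Finset.sum_le_sum fun j _ => hhalf i j
      _ = ∑ i, ∑ j, (if G.Adj i j then ψ i ^ 2 / 2 else 0) +
            ∑ i, ∑ j, (if G.Adj i j then ψ j ^ 2 / 2 else 0) := by
          rw [← Finset.sum_add_distrib]
          refine Finset.sum_congr rfl fun i _ => ?_
          rw [← Finset.sum_add_distrib]
          refine Finset.sum_congr rfl fun j _ => ?_
          split_ifs <;> ring
      _ = 2 * ∑ i, ∑ j, (if G.Adj i j then ψ i ^ 2 / 2 else 0) := by
          rw [two_mul]
          congr 1
          rw [Finset.sum_comm]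
          refine Finset.sum_congr rfl fun i _ => Finset.sum_congr rfl fun j _ => ?_
          simp only [G.adj_comm]
      _ = ∑ i, (G.degree i : ℝ) * ψ i ^ 2 := by
          rw [Finset.mul_sum]
          refine Finset.sum_congr rfl fun i _ => ?_
          rw [← Finset.sum_filter, ← SimpleGraph.neighborFinset_eq_filter, Finset.sum_const,
            SimpleGraph.card_neighborFinset_eq_degree, nsmul_eq_mul]
          ring
      _ ≤ Δ * ∑ x, ψ x ^ 2 := by
          rw [Finset.mul_sum]
          exact Finset.sum_le_sum fun i _ =>
            mul_le_mul_of_nonneg_right (by exact_mod_cast hdeg i) (sq_nonneg _)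
  rw [HSLangevin.couplingMatrix, add_mulVec, dotProduct_add, smul_mulVec, smul_mulVec, one_mulVec,
    dotProduct_smul, dotProduct_smul, hself, smul_eq_mul, smul_eq_mul]
  have hβ : -(|β| * (Δ * ∑ x, ψ x ^ 2)) ≤ β * (ψ ⬝ᵥ G.adjMatrix ℝ *ᵥ ψ) := by
    have h1 : |β * (ψ ⬝ᵥ G.adjMatrix ℝ *ᵥ ψ)| ≤ |β| * (Δ * ∑ x, ψ x ^ 2) := by
      rw [abs_mul]
      exact mul_le_mul_of_nonneg_left hA (abs_nonneg β)
    linarith [neg_abs_le (β * (ψ ⬝ᵥ G.adjMatrix ℝ *ᵥ ψ))]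
  nlinarith [hβ]

/-- **HS exactness of the two-point read-out for the nearest-neighbour Ising model.** On a finite
graph `G` (free boundary condition on the whole vertex set — periodic b.c. for the torus graph), for
`M = κ·1 + β·J_G` coercive and `x ≠ y`:
`∫ tanh((Mψ)_x) tanh((Mψ)_y) fieldMeasure_M(dψ) = ⟨σ_xσ_y⟩^{free}_{V;β,0}`. [cite: BauerschmidtBodineauDagallier2024Polchinski, §6.4.1] -/
theorem integral_tanhField_mul_tanhField_eq_isingTwoPoint (κ β : ℝ) {c : ℝ}
    (hM : IsCoercive (HSLangevin.couplingMatrix G κ β) c) {x y : V} (hxy : x ≠ y) :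
    ∫ ψ, HSLangevin.tanhField (HSLangevin.couplingMatrix G κ β) ψ x *
        HSLangevin.tanhField (HSLangevin.couplingMatrix G κ β) ψ y
        ∂fieldMeasure (HSLangevin.couplingMatrix G κ β) =
      isingTwoPoint G Finset.univ β 0 .free x y := by
  unfold HSLangevin.tanhField
  rw [integral_tanh_mul_tanh_fieldMeasure hM (isSymm_couplingMatrix G κ β) hxy, gibbsTwoPoint,
    isingTwoPoint_eq_spinTwoPoint, spinTwoPoint,
    ← sum_mul_gibbsWeight_div_eq_integral_isingMeasure G κ β (measurable_spinPair x y)]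
  rfl

/-- **HS exactness, σ-marginal form, for the nearest-neighbour Ising model**: for measurable `f`,
`∫ (∑_σ f(σ) P(σ|ψ)) fieldMeasure_M(dψ) = ∫ f dμ^{free}_{V;β,0}` with `M = κ·1 + β·J_G` coercive —
field law followed by the independent read-out `P(σ_x = 1|ψ) = (1 + tanh((Mψ)_x))/2` samples the
Ising measure exactly. [cite: BauerschmidtBodineauDagallier2024Polchinski, §6.4.1] -/
theorem integral_sum_mul_readoutWeight_eq_integral_isingMeasure (κ β : ℝ) {c : ℝ}
    (hM : IsCoercive (HSLangevin.couplingMatrix G κ β) c) {f : SpinConfig V → ℝ}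
    (hf : Measurable f) :
    ∫ ψ, ∑ σ : SpinConfig V, f σ * readoutWeight (HSLangevin.couplingMatrix G κ β) ψ σ
        ∂fieldMeasure (HSLangevin.couplingMatrix G κ β) =
      ∫ σ, f σ ∂isingMeasure G Finset.univ β 0 .free := by
  rw [integral_sum_mul_readoutWeight_fieldMeasure hM (isSymm_couplingMatrix G κ β),
    sum_mul_gibbsWeight_div_eq_integral_isingMeasure G κ β hf]

end Graph

/-! ### The discrete torus -/

section Torus

variable {d N : ℕ}

/-- Every site of the discrete torus `(ℤ/Nℤ)^d` has at most `2d` neighbours (`x ± eᵢ`). [folklore] -/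
theorem degree_torusGraph_le [NeZero N] (x : TorusSite d N) : (torusGraph d N).degree x ≤ 2 * d := by
  classical
  have hsub : (torusGraph d N).neighborFinset x ⊆
      (univ : Finset (Fin d × Bool)).image fun ib =>
        if ib.2 then x + Pi.single ib.1 1 else x - Pi.single ib.1 1 := by
    intro w hw
    rw [SimpleGraph.mem_neighborFinset, torusGraph_adj_iff] at hw
    obtain ⟨-, ⟨i, h⟩ | ⟨i, h⟩⟩ := hw
    · exact Finset.mem_image.2 ⟨(i, true), Finset.mem_univ _, by simp [h]⟩
    · exact Finset.mem_image.2 ⟨(i, false), Finset.mem_univ _, by simp [h]⟩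
  calc (torusGraph d N).degree x = #((torusGraph d N).neighborFinset x) :=
        (SimpleGraph.card_neighborFinset_eq_degree _ _).symm
    _ ≤ #((univ : Finset (Fin d × Bool)).image fun ib =>
          if ib.2 then x + Pi.single ib.1 1 else x - Pi.single ib.1 1) := Finset.card_le_card hsub
    _ ≤ #(univ : Finset (Fin d × Bool)) := Finset.card_image_le
    _ = 2 * d := by simp [Finset.card_univ, mul_comm]

/-- The torus coupling operator `HSLangevin.Mop d κ β N = κ·1 + β·J` is coercive with constant
`κ - 2d|β|` whenever `2d|β| < κ`. [folklore] -/
theorem isCoercive_Mop [NeZero N] {κ β : ℝ} (hκ : |β| * (2 * d) < κ) :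
    IsCoercive (HSLangevin.Mop d κ β N) (κ - |β| * (2 * d)) := by
  have hκ' : |β| * ((2 * d : ℕ) : ℝ) < κ := by push_cast; exact hκ
  have h := isCoercive_couplingMatrix (torusGraph d N) degree_torusGraph_le hκ'
  push_cast at h
  exact h

/-- **HS exactness on the discrete torus** `(ℤ/Nℤ)^d` (periodic boundary condition; the setting
of crux `DilationJoinings`): for `2d|β| < κ` and `x ≠ y`,
`∫ tanh((Mψ)_x) tanh((Mψ)_y) fieldMeasure_M(dψ) = isingTorusTwoPoint d N β 0 x y`,
`M = HSLangevin.Mop d κ β N`. [cite: BauerschmidtBodineauDagallier2024Polchinski, §6.4.1] -/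
theorem integral_tanhField_mul_tanhField_Mop [NeZero N] (κ β : ℝ) (hκ : |β| * (2 * d) < κ)
    {x y : TorusSite d N} (hxy : x ≠ y) :
    ∫ ψ, HSLangevin.tanhField (HSLangevin.Mop d κ β N) ψ x *
        HSLangevin.tanhField (HSLangevin.Mop d κ β N) ψ y ∂fieldMeasure (HSLangevin.Mop d κ β N) =
      isingTorusTwoPoint d N β 0 x y :=
  integral_tanhField_mul_tanhField_eq_isingTwoPoint (torusGraph d N) κ β (isCoercive_Mop hκ) hxy

/-- **HS exactness on the discrete torus, σ-marginal form**: for `2d|β| < κ` and measurable `f`,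
`∫ (∑_σ f(σ) P(σ|ψ)) fieldMeasure_M(dψ) = ∫ f d(isingTorusMeasure d N β 0)`,
`M = HSLangevin.Mop d κ β N`. [cite: BauerschmidtBodineauDagallier2024Polchinski, §6.4.1] -/
theorem integral_sum_mul_readoutWeight_Mop [NeZero N] (κ β : ℝ) (hκ : |β| * (2 * d) < κ)
    {f : SpinConfig (TorusSite d N) → ℝ} (hf : Measurable f) :
    ∫ ψ, ∑ σ : SpinConfig (TorusSite d N), f σ * readoutWeight (HSLangevin.Mop d κ β N) ψ σ
        ∂fieldMeasure (HSLangevin.Mop d κ β N) =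
      ∫ σ, f σ ∂isingTorusMeasure d N β 0 :=
  integral_sum_mul_readoutWeight_eq_integral_isingMeasure (torusGraph d N) κ β (isCoercive_Mop hκ) hf

end Torus

end KacSiegert

end Literature.Probability.LatticeModels
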